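import Summits.MatrixMultiplication.MatrixMultiplication.Theses.DefinableSTPPDichotomy

/-!
# `HexagonClearanceR` (stmt-MatrixMultiplication-17884): the proviso `0 < η` is load-bearing

Refuter lane (`Theorems/HexagonClearanceR/Negative/`; crux-attack, generation 2, 2026-08-17).
`sorry`-free; no theorem here asserts a Theses decl positively.

`HexagonClearanceR` (the repaired seam of route `DefinableSTPPDichotomy`) asks: for all ring formulas
there is `ε₀ > 0` such that for `0 < ε ≤ ε₀` and `0 < η` there is `q₁` with — in every finite field of
characteristic `≥ q₁` — every realised definable family in `F^m` satisfying the `≥ 2`-equal-label STPP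
patterns and the mass bound `|F|^{m+η} ≤ Σ_I (|A||B||C|)^{(2+ε)/3}` has a FULLY STPP sub-family `J ⊆ I`
with `|F|^m < Σ_J (|A||B||C|)^{(2+ε)/3}`.

* `hexagonClearanceR_false_without_eta_pos` — the same statement with `0 < η` WEAKENED to `0 ≤ η`
  (verbatim otherwise; written out inline, no auxiliary definition) is FALSE.
  Witness (works against every `ε₀`, at `ε = ε₀`, `η = 0`, in every prime field `𝔽_p`, `p ≥ max q₁ 3`):
  rank `m = 1`, labels `x ∈ I = F` (`e = 1`, no parameters), SINGLETON blocks `A_x = {0}`,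
  `B_x = {x}`, `C_x = {−x}` (ring formulas `v₀ = 0`, `v₀ = x₀`, `v₀ + x₀ = 0`).  The three label maps
  `x ↦ 0, x, −x` have pairwise-injective differences (`char F ≠ 2`), so every `≥ 2`-equal-label
  pattern holds; the mass is `Σ_x 1 = |F| = |F|^{1+0}` exactly; but no `J ⊆ I` can have
  `Σ_J 1 = |J| > |F|`.  (The 3-label pattern fails — `x − 2y + z = 0` has proper solutions — but the
  conclusion is out of reach for counting reasons alone.)
  Moral: at `η = 0` the hypothesis admits exact-mass families of bounded blocks, for which the
  strict conclusion `|F|^m < mass(J)` is impossible; the `q^η` slack is what forces growing blocks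
  (`(abc)^{ε/3} ≥ q^η` for some block, by the three packings and AM–GM) and puts the seam in the tight
  `(d,d,d)` regime analysed in `Cruxes/HexagonClearanceR/BirthVetting.lean`.
-/

-- single-conjunct summit: the mandated namespace repeats a component (dupNamespace linter).
set_option linter.dupNamespace false

namespace Summit.MatrixMultiplication.MatrixMultiplication.Theorems.HexagonClearanceR.Negative

open Finset FirstOrder FirstOrder.Language
open Summit.MatrixMultiplication.MatrixMultiplication.Theses.DefinableSTPPDichotomy

/-- Read-back: the crux unfolds, by `Iff.rfl`, to the verbatim body below. -/
theorem crux_iff : HexagonClearanceR ↔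
    ∀ (e m k : ℕ) (φI : FirstOrder.Language.ring.Formula (Fin e ⊕ Fin k)) (φA φB φC : FirstOrder.Language.ring.Formula ((Fin e ⊕ Fin m) ⊕ Fin k)), ∃ ε₀ : ℝ, 0 < ε₀ ∧ ∀ ε η : ℝ, 0 < ε → ε ≤ ε₀ → 0 < η → ∃ q₁ : ℕ, ∀ (F : Type) [Field F] [Fintype F] [FirstOrder.Ring.CompatibleRing F], q₁ ≤ ringChar F → ∀ (y : Fin k → F) (I : Finset (Fin e → F)) (A B C : (Fin e → F) → Finset (Fin m → F)), (∀ x, x ∈ I ↔ φI.Realize (Sum.elim x y)) → (∀ x v, v ∈ A x ↔ φA.Realize (Sum.elim (Sum.elim x v) y)) → (∀ x v, v ∈ B x ↔ φB.Realize (Sum.elim (Sum.elim x v) y)) → (∀ x v, v ∈ C x ↔ φC.Realize (Sum.elim (Sum.elim x v) y)) → (∀ i ∈ I, ∀ j ∈ I, ∀ k ∈ I, (i = j ∨ j = k ∨ k = i) → ∀ s ∈ A k, ∀ s' ∈ A i, ∀ t ∈ B i, ∀ t' ∈ B j, ∀ u ∈ C j, ∀ u' ∈ C k, (s' - s) + (t'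 - t) + (u' - u) = 0 → i = j ∧ j = k ∧ s = s' ∧ t = t' ∧ u = u') → (Fintype.card F : ℝ) ^ ((m : ℝ) + η) ≤ ∑ x ∈ I, (((A x).card * (B x).card * (C x).card : ℕ) : ℝ) ^ ((2 + ε) / 3) → ∃ J : Finset (Fin e → F), J ⊆ I ∧ (∀ i ∈ J, ∀ j ∈ J, ∀ k ∈ J, ∀ s ∈ A k, ∀ s' ∈ A i, ∀ t ∈ B i, ∀ t' ∈ B j, ∀ u ∈ C j, ∀ u' ∈ C k, (s' - s) + (t' - t) + (u' - u) = 0 → i = j ∧ j = k ∧ s = s' ∧ t = t' ∧ u = u') ∧ (Fintype.card F : ℝ) ^ (m : ℝ) < ∑ x ∈ J, (((A x).card * (B x).card * (C x).card : ℕ) : ℝ) ^ ((2 + ε) / 3) :=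
  Iff.rfl

section Witness

/-- Realisation of the ring formula `v₀ = 0`: `A_x = {0}` (variables: label `x : Fin 1`, vector
`v : Fin 1`, no parameters). -/
private theorem mem_A_iff_realize {F : Type} [Field F] [FirstOrder.Ring.CompatibleRing F]
    (y : Fin 0 → F) (x : Fin 1 → F) (v : Fin 1 → F) :
    v ∈ ({0} : Finset (Fin 1 → F)) ↔
      (Term.equal (Term.var (Sum.inl (Sum.inr 0))) 0 :
        Language.ring.Formula ((Fin 1 ⊕ Fin 1) ⊕ Fin 0)).Realize (Sum.elim (Sum.elim x v) y) := by
  rw [Finset.mem_singleton]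
  simp [Formula.realize_equal, funext_iff, Fin.forall_fin_one]

/-- Realisation of the ring formula `v₀ = x₀`: `B_x = {x}`. -/
private theorem mem_B_iff_realize {F : Type} [Field F] [FirstOrder.Ring.CompatibleRing F]
    (y : Fin 0 → F) (x : Fin 1 → F) (v : Fin 1 → F) :
    v ∈ ({x} : Finset (Fin 1 → F)) ↔
      (Term.equal (Term.var (Sum.inl (Sum.inr 0))) (Term.var (Sum.inl (Sum.inl 0))) :
        Language.ring.Formula ((Fin 1 ⊕ Fin 1) ⊕ Fin 0)).Realize (Sum.elim (Sum.elim x v) y) := by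
  rw [Finset.mem_singleton]
  simp [Formula.realize_equal, funext_iff, Fin.forall_fin_one]

/-- Realisation of the ring formula `v₀ + x₀ = 0`: `C_x = {−x}`. -/
private theorem mem_C_iff_realize {F : Type} [Field F] [FirstOrder.Ring.CompatibleRing F]
    (y : Fin 0 → F) (x : Fin 1 → F) (v : Fin 1 → F) :
    v ∈ ({-x} : Finset (Fin 1 → F)) ↔
      (Term.equal (Term.var (Sum.inl (Sum.inr 0)) + Term.var (Sum.inl (Sum.inl 0))) 0 :
        Language.ring.Formula ((Fin 1 ⊕ Fin 1) ⊕ Fin 0)).Realize (Sum.elim (Sum.elim x v) y) := by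
  rw [Finset.mem_singleton]
  simp [Formula.realize_equal, funext_iff, Fin.forall_fin_one, eq_neg_iff_add_eq_zero]

end Witness

/-- LOAD-BEARING `0 < η`: the statement below is `HexagonClearanceR` VERBATIM except that `0 < η` is
weakened to `0 ≤ η` — and it is false.  Witness: `m = e = 1`, `k = 0`, `I = F`,
singleton blocks `A_x = {0}`, `B_x = {x}`, `C_x = {−x}` in a prime field `𝔽_p`, `p ≥ max q₁ 3`,
at `ε = ε₀`, `η = 0`: pairwise patterns hold (`char ≠ 2`), mass `= |F|` exactly, and `|J| ≤ |F|`
for every `J ⊆ I`. -/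
theorem hexagonClearanceR_false_without_eta_pos : ¬ (∀ (e m k : ℕ) (φI : FirstOrder.Language.ring.Formula (Fin e ⊕ Fin k)) (φA φB φC : FirstOrder.Language.ring.Formula ((Fin e ⊕ Fin m) ⊕ Fin k)), ∃ ε₀ : ℝ, 0 < ε₀ ∧ ∀ ε η : ℝ, 0 < ε → ε ≤ ε₀ → 0 ≤ η → ∃ q₁ : ℕ, ∀ (F : Type) [Field F] [Fintype F] [FirstOrder.Ring.CompatibleRing F], q₁ ≤ ringChar F → ∀ (y : Fin k → F) (I : Finset (Fin e → F)) (A B C : (Fin e → F) → Finset (Fin m → F)), (∀ x, x ∈ I ↔ φI.Realize (Sum.elim x y)) → (∀ x v, v ∈ A x ↔ φA.Realize (Sum.elim (Sum.elim x v) y)) → (∀ x v, v ∈ B x ↔ φB.Realize (Sum.elim (Sum.elim x v) y)) → (∀ x v, v ∈ C x ↔ φC.Realize (Sum.elim (Sum.elim x v) y)) → (∀ i ∈ I, ∀ j ∈ I, ∀ k ∈ I, (i = j ∨ j = k ∨ k = i) → ∀ s ∈ A k, ∀ s' ∈ A i, ∀ t ∈ B i, ∀ t' ∈ B j, ∀ u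 ∈ C j, ∀ u' ∈ C k, (s' - s) + (t' - t) + (u' - u) = 0 → i = j ∧ j = k ∧ s = s' ∧ t = t' ∧ u = u') → (Fintype.card F : ℝ) ^ ((m : ℝ) + η) ≤ ∑ x ∈ I, (((A x).card * (B x).card * (C x).card : ℕ) : ℝ) ^ ((2 + ε) / 3) → ∃ J : Finset (Fin e → F), J ⊆ I ∧ (∀ i ∈ J, ∀ j ∈ J, ∀ k ∈ J, ∀ s ∈ A k, ∀ s' ∈ A i, ∀ t ∈ B i, ∀ t' ∈ B j, ∀ u ∈ C j, ∀ u' ∈ C k, (s' - s) + (t' - t) + (u' - u) = 0 → i = j ∧ j = k ∧ s = s' ∧ t = t' ∧ u = u') ∧ (Fintype.card F : ℝ) ^ (m : ℝ) < ∑ x ∈ J, (((A x).card * (B x).card * (C x).card : ℕ) : ℝ) ^ ((2 + ε) / 3)) := by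
  intro H
  classical
  obtain ⟨ε₀, hε₀, H1⟩ := H 1 1 0 ⊤ (Term.equal (Term.var (Sum.inl (Sum.inr 0))) 0)
    (Term.equal (Term.var (Sum.inl (Sum.inr 0))) (Term.var (Sum.inl (Sum.inl 0))))
    (Term.equal (Term.var (Sum.inl (Sum.inr 0)) + Term.var (Sum.inl (Sum.inl 0))) 0)
  obtain ⟨q₁, hq₁⟩ := H1 ε₀ 0 hε₀ le_rfl le_rfl
  -- a prime `p ≥ max q₁ 3` and the prime field `𝔽_p`
  obtain ⟨p, hp_ge, hp⟩ := Nat.exists_infinite_primes (max q₁ 3)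
  haveI : Fact p.Prime := ⟨hp⟩
  haveI : NeZero p := ⟨hp.ne_zero⟩
  letI : FirstOrder.Ring.CompatibleRing (ZMod p) := FirstOrder.Ring.compatibleRingOfRing (ZMod p)
  have hchar : q₁ ≤ ringChar (ZMod p) := by
    rw [ZMod.ringChar_zmod_n]
    exact le_of_max_le_left hp_ge
  have h2 : (2 : ZMod p) ≠ 0 := by
    intro h
    have h' : ((2 : ℕ) : ZMod p) = 0 := by exact_mod_cast h
    rw [ZMod.natCast_eq_zero_iff] at h'
    have := Nat.le_of_dvd two_pos h'
    have := le_of_max_le_right hp_ge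
    omega
  have hcardF : Fintype.card (ZMod p) = p := ZMod.card p
  have hQpos : (0 : ℝ) < Fintype.card (ZMod p) := by exact_mod_cast Fintype.card_pos
  -- instantiate the weakened seam at the singleton family
  have key := hq₁ (ZMod p) hchar ![] univ (fun _ => {0}) (fun x => {x}) (fun x => {-x})
    (fun x => by simp) (mem_A_iff_realize ![]) (mem_B_iff_realize ![]) (mem_C_iff_realize ![])
  obtain ⟨J, -, -, hJmass⟩ := key
    (by
      intro i _ j _ k _ hcase s hs s' hs' t ht t' ht' u hu u' hu' hsum
      rw [Finset.mem_singleton] at hs hs' ht ht' hu hu'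
      subst hs hs' ht ht' hu hu'
      have e0 := congrFun hsum 0
      simp only [Pi.add_apply, Pi.sub_apply, Pi.neg_apply, Pi.zero_apply, sub_zero] at e0
      have hijk : t 0 = t' 0 ∧ t' 0 = k 0 := by
        rcases hcase with h | h | h
        · have h0 := congrFun h 0
          exact ⟨h0, by linear_combination e0 + h0⟩
        · have h0 := congrFun h 0
          exact ⟨by linear_combination -e0 + h0, h0⟩
        · have h0 := congrFun h 0
          have h22 : (2 : ZMod p) * (t' 0 - t 0) = 0 := by linear_combination e0 + h0
          have h3 : t' 0 - t 0 = 0 := (mul_eq_zero.1 h22).resolve_left h2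
          exact ⟨by linear_combination -h3, by linear_combination h3 - h0⟩
      have hij : t = t' := funext fun l => by rw [Fin.fin_one_eq_zero l]; exact hijk.1
      have hjk : t' = k := funext fun l => by rw [Fin.fin_one_eq_zero l]; exact hijk.2
      exact ⟨hij, hjk, rfl, hij, by rw [hjk]⟩)
    (by
      simp only [card_singleton, mul_one, Nat.cast_one, Real.one_rpow, sum_const, card_univ,
        Fintype.card_fun, Fintype.card_fin, pow_one, nsmul_eq_mul, add_zero, Real.rpow_one]
      rfl)
  -- the mass of `J` is `|J| ≤ |F|`, contradicting `|F| < mass(J)`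
  simp only [card_singleton, mul_one, Nat.cast_one, Real.one_rpow, sum_const, nsmul_eq_mul,
    Real.rpow_one] at hJmass
  have hJle : (J.card : ℝ) ≤ Fintype.card (ZMod p) := by
    have h := Finset.card_le_univ J
    rw [Fintype.card_fun, Fintype.card_fin, pow_one] at h
    exact_mod_cast h
  linarith

end Summit.MatrixMultiplication.MatrixMultiplication.Theorems.HexagonClearanceR.Negative
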